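import Summits.BirchSwinnertonDyer.BirchSwinnertonDyer.Theorems.SignedLowerHalvesSmallImageLowerHalfBothSignsMuRiderParityPackets
import Summits.BirchSwinnertonDyer.BirchSwinnertonDyer.Theorems.SignedLowerHalvesKobayashiMainConjectureSmallImageTeichSpanLevelDescent
import HarnessLib

/-!
# Route `SignedLowerHalves` (K3), crux L `SmallImageLowerHalfBothSigns` (item stmt-BirchSwinnertonDyer-23599), line
# `birth_acns` v14, stub `stub_muBothSigns_ns`: THE PARITY LINK AT `p = 3` — gen 3's PARITY-SPAN(3) implies gen 4's
# PARITY-PACKET hypothesis (cell `bsd-ssimc`, width seat `bsd-line-slh-p3-w2` gen 5; helper `--supports 23599`; THEOREMS ONLY)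

HONEST FRAMING.  The registered stub `stub_muBothSigns_ns` (`μ(L_p⁺) = μ(L_p⁻) = 0` at every small-image supersingular
X7 pair; Pollack 2003 Conj. 6.3 on an infinite class) is OPEN and is NOT proved here; the verdict of record
(`stub-misstated`, gens 0/2/3/4) stands.  This file proves NO statement about any curve or level: it ORDERS the two
sufficient hypotheses the seat typed for the second sign at `p = 3`, by pure group theory in `Γ₀(N)`:
gen 3 (`…MuRiderParitySpanThree`) PARITY-SPAN(3, π) = `SpanModBy N 3 S_π` (`S_even = {γ | IsGoodAt 9 γ}`,
`S_odd = {γ | |d_γ| = 3^{2k+1}}`; one parity half of THEOREM B's good set spans `pr Γ₁(N)` mod `3` up to the Eisenstein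
part) ⟹ gen 4 (`…MuRiderParityPackets`) PARITY-PACKETS(N,3,π) (some `S` of parity-`π` Teichmüller packet products,
finite-order / trace-`±2` elements and cubes with `γ·γ^ι ∈ ⟨S⟩·[Γ₀(N),Γ₀(N)]` for every good `γ`).

THE LINK (`p = 3` only).  At `p = 3` a Teichmüller packet at level `n` is a PAIR `{g, g'}` with `d = 3ⁿ`, `b' ≡ −b`, and
`ι(g) = (a −b; −c d)` is such a partner: `g·ι(g)` IS a parity-`n` packet product (`isTeichPacket_pair_iota_three`).  So
the homomorphism `Φ(γ) = ψ(γ)·ψ(ιγ)` (`ψ : Γ₀(N) → Γ₀(N)ᵃᵇ / image ⟨S_π⟩`, an abelian group) kills the parity-`π` good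
elements, the trivial elements, the cubes and the commutators; PARITY-SPAN(3, π) then puts `Γ₁(N) = ker(d mod N)` in
`ker Φ`, which is thus a union of `d`-cosets containing `d ≡ −1, 27` and `9` (even) resp. `3` (odd), hence `d ≡ ±3ᵐ` for
all `m` = EVERY good `γ` (`exists_parityPackets_three_of_spanModBy`, `…_even`, `…_odd`).  With gen 4's level form:
PARITY-SPAN(3, π) ⟹ a UNIT Teichmüller-orbit sum `S_f(3, n, u)` at a parity-`π` level `n ≥ 1` for every rational newform
`f` with `a₃(f) = 0`, `3 ∤ N` (`exists_norm_teichOrbitSum_eq_one_of_spanModBy_even_three` / `…_odd_three`).  No converse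
is claimed (a functional with `φ∘ι = −φ` kills all packets, not all good elements: PARITY-PACKETS reads in the plus
quotient `H₁⁺`, PARITY-SPAN in all of `H₁`), and the `ι`-trick has no analogue at `p ≥ 5` (a packet has `p − 1 > 2`
members).  At `p = 3` the typed lattice for the second sign now reads `LS-0(3) ⟹ LayerEisSpanTwoModGen ⟹ PARITY-SPAN(3)
⟹ PARITY-PACKETS(3) ⟹ μ(L₃^ε) = 0` (last arrow = gen 4 §2), every arrow kernel-checked, every hypothesis OPEN class-wide.
BSD, child L, crux 4 and the stub are NOT proved by any of this.

References: [Manin1972] Prop. 1.4; [MazurTateTeitelbaum1986Invent] §I.10 (10.1); [Sun2007] §4; [Stevens1982] §1.1.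
-/

-- D-0017: single-problem summit, the namespace repeats the problem name by design.
set_option linter.dupNamespace false
set_option autoImplicit false

noncomputable section

open scoped Classical MatrixGroups ModularForm

open CongruenceSubgroup Matrix Matrix.SpecialLinearGroup
  Literature.NumberTheory.EllipticCurves Literature.NumberTheory.EllipticCurves.ModularForms
  Literature.NumberTheory.EllipticCurves.Rank1Residual

namespace Summit.BirchSwinnertonDyer.BirchSwinnertonDyer.Theorems.SmallImageLowerHalfBothSignsMuRiderParityLink

open Summit.BirchSwinnertonDyer.BirchSwinnertonDyer.Cruxes.AnalyticMuZeroX9.TeichSpan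
open Summit.BirchSwinnertonDyer.BirchSwinnertonDyer.Theorems.SmallImageTeichSpanLevelDescent (iotaGamma0_mul)
open Summit.BirchSwinnertonDyer.BirchSwinnertonDyer.Theorems.SmallImageLowerHalfBothSignsMuRiderParityPackets
  (exists_norm_teichOrbitSum_eq_one_of_parityPackets)

variable {N : ℕ}

/-! ## §1 Bookkeeping in `Γ₀(N)`: `−I`, `ι`, elements of prescribed `d`-entry, level `0`, the `ι`-pair packet at `p = 3` -/

/-- `d(−I·g) = −d(g)`. [cite: Stevens1982, §1.1] -/
theorem dEntry_negOneGamma0_mul (g : Gamma0 N) : dEntry (negOneGamma0 N * g) = -dEntry g := by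
  simp [dEntry, negOneGamma0]

/-- `(−I)·(−I)·g = g`. [cite: Stevens1982, §1.1] -/
theorem negOneGamma0_mul_negOneGamma0_mul (g : Gamma0 N) : negOneGamma0 N * (negOneGamma0 N * g) = g := by
  rw [← mul_assoc, negOneGamma0_mul_negOneGamma0, one_mul]

/-- `ι(−I) = −I`. [cite: Manin1972, Prop. 1.4] -/
theorem iotaGamma0_negOneGamma0 : iotaGamma0 (negOneGamma0 N) = negOneGamma0 N := by
  apply Subtype.ext; ext i j; fin_cases i <;> fin_cases j <;> simp [iotaSL, negOneGamma0]

/-- `ι(1) = 1`. [cite: Manin1972, Prop. 1.4] -/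
theorem iotaGamma0_one : iotaGamma0 (1 : Gamma0 N) = 1 := by
  apply Subtype.ext; ext i j; fin_cases i <;> fin_cases j <;> simp [iotaSL]

/-- `ι` as a group endomorphism of `Γ₀(N)` (conjugation by `diag(−1,1)`). [cite: Manin1972, Prop. 1.4] -/
theorem iotaGamma0_pow (g : Gamma0 N) (n : ℕ) : iotaGamma0 (g ^ n) = iotaGamma0 g ^ n := by
  induction n with
  | zero => rw [pow_zero, pow_zero, iotaGamma0_one]
  | succ n ih => rw [pow_succ, pow_succ, iotaGamma0_mul, ih]

/-- `ι` preserves finite order. [cite: Manin1972, Prop. 1.4] -/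
theorem isOfFinOrder_iotaGamma0 {g : Gamma0 N} (h : IsOfFinOrder g) : IsOfFinOrder (iotaGamma0 g) := by
  obtain ⟨n, hn, hgn⟩ := h.exists_pow_eq_one
  exact isOfFinOrder_iff_pow_eq_one.mpr ⟨n, hn, by rw [← iotaGamma0_pow, hgn, iotaGamma0_one]⟩

/-- For a prime `p ∤ N` and every `k` there is `g = (u, −w; N, pᵏ) ∈ Γ₀(N)` with `d`-entry EXACTLY `pᵏ`
(`u·pᵏ + w·N = 1`; Sun 2007 §4: `(u a; Nv ℓⁿ)`). [cite: Sun2007, §4] -/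
theorem exists_dEntry_eq_pow {p : ℕ} (hp : p.Prime) (hpN : ¬ p ∣ N) (k : ℕ) :
    ∃ g : Gamma0 N, dEntry g = (p : ℤ) ^ k := by
  have hcop : (p ^ k).Coprime N := Nat.Coprime.pow_left k ((Nat.Prime.coprime_iff_not_dvd hp).mpr hpN)
  obtain ⟨u, w, huw⟩ := Nat.isCoprime_iff_coprime.mpr hcop
  have hdet : Matrix.det !![u, -w; (N : ℤ), ((p ^ k : ℕ) : ℤ)] = 1 := by
    rw [Matrix.det_fin_two_of]
    linear_combination huw
  refine ⟨⟨⟨!![u, -w; (N : ℤ), ((p ^ k : ℕ) : ℤ)], hdet⟩, ?_⟩, ?_⟩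
  · rw [Gamma0_mem]
    simp
  · simp [dEntry]

/-- LEVEL `0` DIES: an element of `Γ₀(N)` with `d = 1` is `(1 b; 0 1)·(1 0; c 1)`, a product of two trace-`2`
(parabolic) elements of `Γ₀(N)`; so every `γ` with `|d_γ| = 1` lies in the subgroup generated by the finite-order and
trace-`±2` elements (with `−I` for `d = −1`) — under Manin's map, `{0 → γ·0} = {0 → b} = 0`. [cite: Manin1972, Prop. 1.4] -/
theorem mem_closure_trivial_of_natAbs_dEntry_eq_one {S : Set (Gamma0 N)}
    (hS : ∀ γ : Gamma0 N, (IsOfFinOrder γ ∨ trEntry γ = 2 ∨ trEntry γ = -2) → γ ∈ S)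
    {g : Gamma0 N} (hg : (dEntry g).natAbs = 1) : g ∈ Subgroup.closure S := by
  -- first the case `d = 1`
  have key : ∀ g : Gamma0 N, dEntry g = 1 → g ∈ Subgroup.closure S := by
    intro g hd
    have hdet := (g : SL(2, ℤ)).det_coe
    rw [Matrix.det_fin_two] at hdet
    have hd' : (g : SL(2, ℤ)) 1 1 = 1 := hd
    have hc : (((g : SL(2, ℤ)) 1 0 : ℤ) : ZMod N) = 0 := Gamma0_mem.mp g.2
    -- the two parabolic factors
    have hdetU : Matrix.det !![(1 : ℤ), (g : SL(2, ℤ)) 0 1; 0, 1] = 1 := by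
      rw [Matrix.det_fin_two_of]; ring
    have hdetV : Matrix.det !![(1 : ℤ), 0; (g : SL(2, ℤ)) 1 0, 1] = 1 := by
      rw [Matrix.det_fin_two_of]; ring
    have hUmem : (⟨!![(1 : ℤ), (g : SL(2, ℤ)) 0 1; 0, 1], hdetU⟩ : SL(2, ℤ)) ∈ Gamma0 N :=
      Gamma0_mem.mpr (by simp)
    have hVmem : (⟨!![(1 : ℤ), 0; (g : SL(2, ℤ)) 1 0, 1], hdetV⟩ : SL(2, ℤ)) ∈ Gamma0 N :=
      Gamma0_mem.mpr (by simpa using hc)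
    set U : Gamma0 N := ⟨⟨!![(1 : ℤ), (g : SL(2, ℤ)) 0 1; 0, 1], hdetU⟩, hUmem⟩ with hU
    set V : Gamma0 N := ⟨⟨!![(1 : ℤ), 0; (g : SL(2, ℤ)) 1 0, 1], hdetV⟩, hVmem⟩ with hV
    have hUtr : trEntry U = 2 := by simp [trEntry, U]
    have hVtr : trEntry V = 2 := by simp [trEntry, V]
    have hgUV : g = U * V := by
      apply Subtype.ext
      ext i j
      have ha : (g : SL(2, ℤ)) 0 0 = 1 + (g : SL(2, ℤ)) 0 1 * (g : SL(2, ℤ)) 1 0 := by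
        rw [hd'] at hdet; linear_combination hdet
      fin_cases i <;> fin_cases j <;>
        simp [U, V, Matrix.mul_apply, Fin.sum_univ_two, ha, hd']
    rw [hgUV]
    exact mul_mem (Subgroup.subset_closure (hS U (Or.inr (Or.inl hUtr))))
      (Subgroup.subset_closure (hS V (Or.inr (Or.inl hVtr))))
  rcases Int.natAbs_eq_iff.mp hg with hd | hd
  · exact key g (by simpa using hd)
  · -- `d = −1`: `g = (−I)·((−I)·g)` and `d((−I)·g) = 1`
    have hd1 : dEntry (negOneGamma0 N * g) = 1 := by rw [dEntry_negOneGamma0_mul, hd]; norm_num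
    rw [← negOneGamma0_mul_negOneGamma0_mul g]
    exact mul_mem (Subgroup.subset_closure (hS _ (Or.inr (Or.inr (trEntry_negOneGamma0 N))))) (key _ hd1)

/-- **THE `ι`-PAIR PACKET AT `p = 3`.**  For `g ∈ Γ₀(N)` with `d`-entry `3ⁿ`, `n ≥ 1`, the pair `[g, ι(g)]` is a
Teichmüller packet of level `n` (`IsTeichPacket N 3 n`): both have `d = 3ⁿ`, the `b`-entries `b, −b` are distinct
mod `3ⁿ` (`3 ∤ b` since `a·3ⁿ − b·c = 1`, and `3 ∤ 2`) and have the common square `b²`.  At `p = 3` the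
Teichmüller group `μ₂ = {±1}` IS `{1, ι}` on the cusps `b/3ⁿ`. [cite: Manin1972, Prop. 1.4]
[cite: MazurTateTeitelbaum1986Invent, §I.10 (10.1)] -/
theorem isTeichPacket_pair_iota_three {n : ℕ} (hn : 1 ≤ n) {g : Gamma0 N} (hd : dEntry g = (3 : ℤ) ^ n) :
    IsTeichPacket N 3 n [g, iotaGamma0 g] := by
  have hdet := (g : SL(2, ℤ)).det_coe
  rw [Matrix.det_fin_two] at hdet
  have hd' : (g : SL(2, ℤ)) 1 1 = (3 : ℤ) ^ n := hd
  -- `3 ∤ b`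
  have h3b : ¬ (3 : ℤ) ∣ bEntry g := by
    intro h3b
    have h3d : (3 : ℤ) ∣ (g : SL(2, ℤ)) 1 1 := by
      rw [hd']; exact dvd_pow_self 3 (by omega)
    have h1 : (3 : ℤ) ∣ (g : SL(2, ℤ)) 0 0 * (g : SL(2, ℤ)) 1 1 - (g : SL(2, ℤ)) 0 1 * (g : SL(2, ℤ)) 1 0 :=
      dvd_sub (dvd_mul_of_dvd_right h3d _) (dvd_mul_of_dvd_left h3b _)
    rw [hdet] at h1
    norm_num at h1
  refine ⟨by norm_num, ?_, ?_, ⟨((bEntry g : ℤ) : ZMod (3 ^ n)) ^ (3 - 1), ?_⟩⟩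
  · intro g' hg'
    simp only [List.mem_cons, List.not_mem_nil, or_false] at hg'
    rcases hg' with rfl | rfl
    · exact_mod_cast hd
    · rw [dEntry_iotaGamma0]; exact_mod_cast hd
  · simp only [List.map_cons, List.map_nil, List.nodup_cons, List.mem_singleton, List.not_mem_nil,
      not_false_eq_true, List.nodup_nil, and_true, bEntry_iotaGamma0, Int.cast_neg]
    intro heq
    -- `b ≡ −b (mod 3ⁿ)` ⟹ `3ⁿ ∣ 2b` ⟹ `3 ∣ b`
    have h2b : ((2 * bEntry g : ℤ) : ZMod (3 ^ n)) = 0 := by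
      push_cast; rw [two_mul]; nth_rw 1 [heq]; ring
    rw [ZMod.intCast_zmod_eq_zero_iff_dvd] at h2b
    have h3 : (3 : ℤ) ∣ 2 * bEntry g :=
      dvd_trans (by exact_mod_cast dvd_pow_self 3 (by omega : n ≠ 0)) h2b
    have hp3 : Prime (3 : ℤ) := Int.prime_three
    rcases hp3.dvd_or_dvd h3 with h | h
    · norm_num at h
    · exact h3b h
  · intro g' hg'
    simp only [List.mem_cons, List.not_mem_nil, or_false] at hg'
    rcases hg' with rfl | rfl
    · rfl
    · rw [bEntry_iotaGamma0, Int.cast_neg, show (3 - 1 : ℕ) = 2 from rfl, neg_sq]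

/-! ## §2 The link: PARITY-SPAN(3, π) ⟹ PARITY-PACKETS(N, 3, π) -/

/-- **ENGINE.**  `3 ∤ N`; `T ⊆ Γ₀(N)` a test set of good elements each of level `0` or of a level `m ≥ 1` of parity `π`,
containing some element with `d`-entry `3` or `9`.  IF `SpanModBy N 3 T` (the classes of `T` span `pr Γ₁(N)` mod `3` up
to the Eisenstein part) THEN the parity-`π` packet hypothesis of gen 4 holds at `(N, 3, π)`: with
`S = {parity-π packet products} ∪ {finite order, trace ±2} ∪ {cubes}`, every good `γ` has `γ·γ^ι ∈ ⟨S⟩·[Γ₀(N),Γ₀(N)]`.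
Proof: `Φ(γ) = ψ(γ)ψ(ιγ)` into the abelian group `Γ₀(N)ᵃᵇ/⟨S⟩` kills `T` (level `0` dies; at level `m ≥ 1`, `g·ιg` is a
packet product, after replacing `g` by `−I·g` if `d < 0`), the trivial elements, the cubes, the commutators, hence
(`SpanModBy`) `Γ₁(N)`; `ker Φ` is then a union of `d (mod N)`-cosets containing `d ≡ −1, 27` and `9` or `3`, so `d ≡ ±3ᵐ`
for all `m`. [cite: Manin1972, Prop. 1.4] [cite: Stevens1982, §1.1] -/
theorem exists_parityPackets_three_of_spanModBy (π : ℕ) (h3N : ¬ 3 ∣ N) {T : Set (Gamma0 N)}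
    (hT : ∀ γ ∈ T, ∃ m : ℕ, (dEntry γ).natAbs = 3 ^ m ∧ (m = 0 ∨ (1 ≤ m ∧ m % 2 = π % 2)))
    (hgen : ∃ t ∈ T, dEntry t = 3 ∨ dEntry t = 9) (h : SpanModBy N 3 T) :
    ∃ S : Set (Gamma0 N),
      (∀ γ ∈ S, (∃ (n : ℕ) (l : List (Gamma0 N)), 1 ≤ n ∧ n % 2 = π % 2 ∧ IsTeichPacket N 3 n l ∧ γ = l.prod) ∨
        (IsOfFinOrder γ ∨ trEntry γ = 2 ∨ trEntry γ = -2) ∨ ∃ h : Gamma0 N, γ = h ^ 3) ∧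
      ∀ γ : Gamma0 N, IsGoodAt 3 γ → γ * iotaGamma0 γ ∈ Subgroup.closure S ⊔ commutator (Gamma0 N) := by
  classical
  -- the generating set
  set S : Set (Gamma0 N) := {γ | (∃ (n : ℕ) (l : List (Gamma0 N)), 1 ≤ n ∧ n % 2 = π % 2 ∧
      IsTeichPacket N 3 n l ∧ γ = l.prod) ∨ (IsOfFinOrder γ ∨ trEntry γ = 2 ∨ trEntry γ = -2) ∨
      ∃ h : Gamma0 N, γ = h ^ 3} with hSdef
  refine ⟨S, fun γ hγ ↦ hγ, ?_⟩
  have hStriv : ∀ γ : Gamma0 N, (IsOfFinOrder γ ∨ trEntry γ = 2 ∨ trEntry γ = -2) → γ ∈ S :=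
    fun γ hγ ↦ Or.inr (Or.inl hγ)
  have hScube : ∀ h : Gamma0 N, h ^ 3 ∈ S := fun h ↦ Or.inr (Or.inr ⟨h, rfl⟩)
  -- the abelian target `Q = Γ₀(N)ᵃᵇ / image ⟨S⟩` and `ψ : Γ₀(N) → Q`
  set A := Abelianization (Gamma0 N)
  set HA : Subgroup A := (Subgroup.closure S).map Abelianization.of with hHA
  set ψ : Gamma0 N →* A ⧸ HA := (QuotientGroup.mk' HA).comp Abelianization.of with hψ
  have hψ_iff : ∀ γ : Gamma0 N, ψ γ = 1 ↔ γ ∈ Subgroup.closure S ⊔ commutator (Gamma0 N) := by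
    intro γ
    rw [hψ, MonoidHom.comp_apply, QuotientGroup.mk'_apply, QuotientGroup.eq_one_iff, ← Subgroup.mem_comap, hHA,
      Subgroup.comap_map_eq, Abelianization.ker_of]
  have hψS : ∀ γ ∈ S, ψ γ = 1 := fun γ hγ ↦ (hψ_iff γ).mpr (Subgroup.mem_sup_left (Subgroup.subset_closure hγ))
  -- `ι` as a monoid endomorphism and `Φ = ψ · (ψ ∘ ι)`
  set ιh : Gamma0 N →* Gamma0 N :=
    { toFun := iotaGamma0, map_one' := iotaGamma0_one, map_mul' := iotaGamma0_mul } with hιh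
  set Φ : Gamma0 N →* A ⧸ HA := ψ * ψ.comp ιh with hΦ
  have hΦ_apply : ∀ γ, Φ γ = ψ (γ * iotaGamma0 γ) := by
    intro γ; rw [hΦ, MonoidHom.mul_apply, MonoidHom.comp_apply, map_mul]; rfl
  have hΦ_iff : ∀ γ, γ ∈ Φ.ker ↔ γ * iotaGamma0 γ ∈ Subgroup.closure S ⊔ commutator (Gamma0 N) := by
    intro γ; rw [MonoidHom.mem_ker, hΦ_apply, hψ_iff]
  -- (a) `−I ∈ ker Φ`, trivial elements, cubes
  have hnegS : negOneGamma0 N ∈ S := hStriv _ (Or.inr (Or.inr (trEntry_negOneGamma0 N)))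
  have hneg : negOneGamma0 N ∈ Φ.ker := by
    rw [MonoidHom.mem_ker, hΦ_apply, iotaGamma0_negOneGamma0, map_mul, hψS _ hnegS, one_mul]
  have htriv : ∀ γ : Gamma0 N, (IsOfFinOrder γ ∨ trEntry γ = 2 ∨ trEntry γ = -2) → γ ∈ Φ.ker := by
    intro γ hγ
    have hι : IsOfFinOrder (iotaGamma0 γ) ∨ trEntry (iotaGamma0 γ) = 2 ∨ trEntry (iotaGamma0 γ) = -2 := by
      rcases hγ with h | h | h
      · exact Or.inl (isOfFinOrder_iotaGamma0 h)
      · exact Or.inr (Or.inl (by rw [trEntry_iotaGamma0, h]))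
      · exact Or.inr (Or.inr (by rw [trEntry_iotaGamma0, h]))
    rw [MonoidHom.mem_ker, hΦ_apply, map_mul, hψS _ (hStriv _ hγ), hψS _ (hStriv _ hι), one_mul]
  have hcube : ∀ y : Gamma0 N, y ^ 3 ∈ Φ.ker := by
    intro y
    rw [MonoidHom.mem_ker, hΦ_apply, map_mul, iotaGamma0_pow, hψS _ (hScube y), hψS _ (hScube _), one_mul]
  -- (b) a good element of level `m ≥ 1` of parity `π` lies in `ker Φ` (the `ι`-pair packet)
  have hlevel : ∀ (m : ℕ), 1 ≤ m → m % 2 = π % 2 → ∀ g : Gamma0 N, (dEntry g).natAbs = 3 ^ m → g ∈ Φ.ker := by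
    intro m hm hpar
    -- first for `d = +3ᵐ`
    have pos : ∀ g : Gamma0 N, dEntry g = (3 : ℤ) ^ m → g ∈ Φ.ker := by
      intro g hd
      have hpk := isTeichPacket_pair_iota_three (N := N) hm hd
      have hmem : g * iotaGamma0 g ∈ S :=
        Or.inl ⟨m, [g, iotaGamma0 g], hm, hpar, hpk, by simp⟩
      rw [MonoidHom.mem_ker, hΦ_apply]
      exact hψS _ hmem
    intro g hg
    rcases Int.natAbs_eq_iff.mp hg with hd | hd
    · exact pos g (by exact_mod_cast hd)
    · have hd' : dEntry (negOneGamma0 N * g) = (3 : ℤ) ^ m := by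
        rw [dEntry_negOneGamma0_mul, hd]; push_cast; ring
      have h1 := pos _ hd'
      rw [← negOneGamma0_mul_negOneGamma0_mul g]
      exact mul_mem hneg h1
  -- (c) level `0` lies in `ker Φ`
  have hzero : ∀ g : Gamma0 N, (dEntry g).natAbs = 1 → g ∈ Φ.ker := by
    intro g hg
    have hg' : (dEntry (iotaGamma0 g)).natAbs = 1 := by rw [dEntry_iotaGamma0, hg]
    have h1 : ψ g = 1 := (hψ_iff g).mpr (Subgroup.mem_sup_left (mem_closure_trivial_of_natAbs_dEntry_eq_one hStriv hg))
    have h2 : ψ (iotaGamma0 g) = 1 :=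
      (hψ_iff _).mpr (Subgroup.mem_sup_left (mem_closure_trivial_of_natAbs_dEntry_eq_one hStriv hg'))
    rw [MonoidHom.mem_ker, hΦ_apply, map_mul, h1, h2, one_mul]
  -- (d) the whole span subgroup of `T` lies in `ker Φ`, hence so does `Γ₁(N)`
  have hT_ker : ∀ γ ∈ T, γ ∈ Φ.ker := by
    intro γ hγ
    obtain ⟨m, hm, h0 | ⟨h1, hpar⟩⟩ := hT γ hγ
    · subst h0; rw [pow_zero] at hm; exact hzero γ hm
    · exact hlevel m h1 hpar γ hm
  have hle : Subgroup.closure (T ∪ trivialGens N ∪ pthPowers N 3) ⊔ commutator (Gamma0 N) ≤ Φ.ker := by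
    refine sup_le ((Subgroup.closure_le _).mpr ?_) (Abelianization.commutator_subset_ker Φ)
    rintro γ ((hγ | hγ) | ⟨y, rfl⟩)
    · exact hT_ker γ hγ
    · exact htriv γ hγ
    · exact hcube y
  have hΓ1 : ∀ γ : Gamma0 N, γ ∈ Gamma1' N → γ ∈ Φ.ker := fun γ hγ ↦ hle (h γ hγ)
  -- (e) `ker Φ` is a union of `d (mod N)`-cosets
  have hcoset : ∀ x y : Gamma0 N, x ∈ Φ.ker → Gamma0Map N y = Gamma0Map N x → y ∈ Φ.ker := by
    intro x y hx hxy
    have h1 : y * x⁻¹ ∈ Gamma1' N := by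
      rw [Gamma1_mem', map_mul, hxy, ← map_mul, mul_inv_cancel, map_one]
    have := mul_mem (hΓ1 _ h1) hx
    rwa [inv_mul_cancel_right] at this
  -- (f) some element of `ker Φ` has `d ≡ 3 (mod N)`
  obtain ⟨g₃, hg₃⟩ := exists_dEntry_eq_pow (N := N) Nat.prime_three h3N 1
  rw [pow_one] at hg₃
  have hg₃map : Gamma0Map N g₃ = (3 : ZMod N) := by
    rw [← intCast_dEntry, hg₃]; push_cast; rfl
  have hk3 : ∃ k : Gamma0 N, k ∈ Φ.ker ∧ Gamma0Map N k = (3 : ZMod N) := by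
    obtain ⟨t, htT, ht | ht⟩ := hgen
    · exact ⟨t, hT_ker t htT, by rw [← intCast_dEntry, ht]; push_cast; rfl⟩
    · -- `d(t) = 9`, `d(g₃³) = 27`: `g₃³·t⁻¹` has `d ≡ 3`
      have htmap : Gamma0Map N t = (9 : ZMod N) := by rw [← intCast_dEntry, ht]; push_cast; rfl
      have h9 : IsUnit (Gamma0Map N t) := isUnit_Gamma0Map N t
      refine ⟨g₃ ^ 3 * t⁻¹, mul_mem (hcube g₃) (inv_mem (hT_ker t htT)), ?_⟩
      apply (h9.mul_left_inj).mp
      rw [← map_mul, inv_mul_cancel_right, map_pow, hg₃map, htmap]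
      norm_num
  obtain ⟨k, hk, hkmap⟩ := hk3
  -- (g) every good `γ` lies in `ker Φ`
  intro γ hγ
  obtain ⟨m, hm⟩ := hγ
  rw [← hΦ_iff]
  have hkm : k ^ m ∈ Φ.ker := pow_mem hk m
  have hkm_map : Gamma0Map N (k ^ m) = (3 : ZMod N) ^ m := by rw [map_pow, hkmap]
  rcases Int.natAbs_eq_iff.mp hm with hd | hd
  · refine hcoset (k ^ m) γ hkm ?_
    rw [hkm_map, ← intCast_dEntry, hd]; push_cast; rfl
  · refine hcoset (negOneGamma0 N * k ^ m) γ (mul_mem hneg hkm) ?_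
    rw [map_mul, hkm_map, gamma0Map_negOneGamma0, ← intCast_dEntry, hd]; push_cast; ring

/-- **EVEN LINK.**  `3 ∤ N`: gen 3's EVEN-SPAN(3) `SpanModBy N 3 {γ | IsGoodAt 9 γ}` ⟹ gen 4's parity-packet hypothesis
at `(N, 3, even)` (packets at even levels `n ≥ 2`). [cite: Manin1972, Prop. 1.4] [cite: Sun2007, §4] -/
theorem exists_parityPackets_even_three_of_spanModBy_even (h3N : ¬ 3 ∣ N)
    (h : SpanModBy N 3 {γ : Gamma0 N | IsGoodAt (3 ^ 2) γ}) :
    ∃ S : Set (Gamma0 N),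
      (∀ γ ∈ S, (∃ (n : ℕ) (l : List (Gamma0 N)), 1 ≤ n ∧ n % 2 = 0 % 2 ∧ IsTeichPacket N 3 n l ∧ γ = l.prod) ∨
        (IsOfFinOrder γ ∨ trEntry γ = 2 ∨ trEntry γ = -2) ∨ ∃ h : Gamma0 N, γ = h ^ 3) ∧
      ∀ γ : Gamma0 N, IsGoodAt 3 γ → γ * iotaGamma0 γ ∈ Subgroup.closure S ⊔ commutator (Gamma0 N) := by
  refine exists_parityPackets_three_of_spanModBy 0 h3N ?_ ?_ h
  · rintro γ ⟨m, hm⟩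
    refine ⟨2 * m, by rw [pow_mul]; exact hm, ?_⟩
    rcases Nat.eq_zero_or_pos m with rfl | hpos
    · exact Or.inl rfl
    · exact Or.inr ⟨by omega, by omega⟩
  · obtain ⟨t, ht⟩ := exists_dEntry_eq_pow (N := N) Nat.prime_three h3N 2
    refine ⟨t, ⟨1, ?_⟩, Or.inr (by rw [ht]; norm_num)⟩
    rw [ht]; norm_num

/-- **ODD LINK.**  `3 ∤ N`: gen 3's ODD-SPAN(3) `SpanModBy N 3 {γ | |d_γ| = 3^{2k+1}}` ⟹ gen 4's parity-packet hypothesis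
at `(N, 3, odd)`. [cite: Manin1972, Prop. 1.4] [cite: Sun2007, §4] -/
theorem exists_parityPackets_odd_three_of_spanModBy_odd (h3N : ¬ 3 ∣ N)
    (h : SpanModBy N 3 {γ : Gamma0 N | ∃ k : ℕ, (dEntry γ).natAbs = 3 ^ (2 * k + 1)}) :
    ∃ S : Set (Gamma0 N),
      (∀ γ ∈ S, (∃ (n : ℕ) (l : List (Gamma0 N)), 1 ≤ n ∧ n % 2 = 1 % 2 ∧ IsTeichPacket N 3 n l ∧ γ = l.prod) ∨
        (IsOfFinOrder γ ∨ trEntry γ = 2 ∨ trEntry γ = -2) ∨ ∃ h : Gamma0 N, γ = h ^ 3) ∧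
      ∀ γ : Gamma0 N, IsGoodAt 3 γ → γ * iotaGamma0 γ ∈ Subgroup.closure S ⊔ commutator (Gamma0 N) := by
  refine exists_parityPackets_three_of_spanModBy 1 h3N ?_ ?_ h
  · rintro γ ⟨k, hk⟩
    exact ⟨2 * k + 1, hk, Or.inr ⟨by omega, by omega⟩⟩
  · obtain ⟨t, ht⟩ := exists_dEntry_eq_pow (N := N) Nat.prime_three h3N 1
    rw [pow_one] at ht
    exact ⟨t, ⟨0, by rw [ht]; norm_num⟩, Or.inl ht⟩

/-! ## §3 Through gen 4's level form: PARITY-SPAN(3, π) ⟹ a UNIT Teichmüller-orbit sum at a parity-`π` level -/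

section Level

variable [NeZero N] {f : CuspForm (Gamma0 N) 2}

/-- **EVEN-SPAN(3) ⟹ a unit orbit sum at an EVEN level.**  `f` a rational normalised newform on `Γ₀(N)`, `3 ∤ N`,
`a₃(f) = 0`, an Eisenstein multiple `n₀{∞,0}_f ∈ Λ_f` with `3 ∤ n₀`, and the winding function non-constant mod `3` on the
`3`-power cusps: EVEN-SPAN(3) at level `N` gives a level `n ≥ 2`, `n` even, and a unit `u` with `S_f(3, n, u)` a `3`-adic
unit (gen 4 `exists_norm_teichOrbitSum_eq_one_of_parityPackets` ∘ `exists_parityPackets_even_three_of_spanModBy_even`).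
[cite: Manin1972, Prop. 1.4] [cite: MazurTateTeitelbaum1986Invent, §I.4 (4.2), §I.10 (10.1)] -/
theorem exists_norm_teichOrbitSum_eq_one_of_spanModBy_even_three (hf : IsNewform0 f) (hQ : coeffField f = ⊥)
    (h3N : ¬ 3 ∣ N) (hap : cuspCoeff f 3 = ((0 : ℤ) : ℂ)) {n₀ : ℤ} (hpn₀ : ¬ (3 : ℤ) ∣ n₀)
    (h0 : (n₀ : ℂ) * modularSymbol f 0 ∈ periodLattice f)
    (h : SpanModBy N 3 {γ : Gamma0 N | IsGoodAt (3 ^ 2) γ})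
    (hw : ∃ (n : ℕ) (a a' : ℤ), 1 ≤ ‖((ratPlusSymbol f ((a : ℚ) / (3 : ℚ) ^ n) -
      ratPlusSymbol f ((a' : ℚ) / (3 : ℚ) ^ n) : ℚ) : ℚ_[3])‖) :
    ∃ n : ℕ, 1 ≤ n ∧ n % 2 = 0 ∧ ∃ u : (ZMod (3 ^ n))ˣ,
      ‖((teichOrbitSum f 3 n (u : ZMod (3 ^ n)) : ℚ) : ℚ_[3])‖ = 1 := by
  obtain ⟨S, hS, hB⟩ := exists_parityPackets_even_three_of_spanModBy_even h3N h
  have hpN : ¬ (3 : ℕ) ∣ N := h3N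
  obtain ⟨n, hn, hpar, u, hu⟩ := exists_norm_teichOrbitSum_eq_one_of_parityPackets (p := 3) hf hQ (by norm_num) hpN
    (by exact_mod_cast hap) (by exact_mod_cast hpn₀) h0 0 hS hB (by exact_mod_cast hw)
  exact ⟨n, hn, by simpa using hpar, u, by exact_mod_cast hu⟩

/-- **ODD-SPAN(3) ⟹ a unit orbit sum at an ODD level** (same frame). [cite: Manin1972, Prop. 1.4]
[cite: MazurTateTeitelbaum1986Invent, §I.4 (4.2), §I.10 (10.1)] -/
theorem exists_norm_teichOrbitSum_eq_one_of_spanModBy_odd_three (hf : IsNewform0 f) (hQ : coeffField f = ⊥)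
    (h3N : ¬ 3 ∣ N) (hap : cuspCoeff f 3 = ((0 : ℤ) : ℂ)) {n₀ : ℤ} (hpn₀ : ¬ (3 : ℤ) ∣ n₀)
    (h0 : (n₀ : ℂ) * modularSymbol f 0 ∈ periodLattice f)
    (h : SpanModBy N 3 {γ : Gamma0 N | ∃ k : ℕ, (dEntry γ).natAbs = 3 ^ (2 * k + 1)})
    (hw : ∃ (n : ℕ) (a a' : ℤ), 1 ≤ ‖((ratPlusSymbol f ((a : ℚ) / (3 : ℚ) ^ n) -
      ratPlusSymbol f ((a' : ℚ) / (3 : ℚ) ^ n) : ℚ) : ℚ_[3])‖) :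
    ∃ n : ℕ, 1 ≤ n ∧ n % 2 = 1 ∧ ∃ u : (ZMod (3 ^ n))ˣ,
      ‖((teichOrbitSum f 3 n (u : ZMod (3 ^ n)) : ℚ) : ℚ_[3])‖ = 1 := by
  obtain ⟨S, hS, hB⟩ := exists_parityPackets_odd_three_of_spanModBy_odd h3N h
  have hpN : ¬ (3 : ℕ) ∣ N := h3N
  obtain ⟨n, hn, hpar, u, hu⟩ := exists_norm_teichOrbitSum_eq_one_of_parityPackets (p := 3) hf hQ (by norm_num) hpN
    (by exact_mod_cast hap) (by exact_mod_cast hpn₀) h0 1 hS hB (by exact_mod_cast hw)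
  exact ⟨n, hn, by simpa using hpar, u, by exact_mod_cast hu⟩

end Level

end Summit.BirchSwinnertonDyer.BirchSwinnertonDyer.Theorems.SmallImageLowerHalfBothSignsMuRiderParityLink

end
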